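import Mathlib
import Summits.KontsevichZagierPeriods.KontsevichZagierPeriods.Theorems.SoloInformedParamCoinI
import Summits.KontsevichZagierPeriods.KontsevichZagierPeriods.Theorems.SoloInformedRealScalars
import HarnessLib

/-!
# Scaled constant terms and scalar increments (THEOREM T⊗, semi-generic step — file A)

Infrastructure for the real-scalar form of THEOREM T (`ℝ ⊗_k P_ℚ → P_ℝ`, residency note
`real-parameters.md` (S2)): formal combinations `x(s) = x₀ + ∑ᵢ sᵢ • Xᵢ` in `KZOver.FormalRep ℝ`
whose scalars `sᵢ` (integrand scaling `soloInformedRealScale`, file `SoloInformedRealScalars`) are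
treated as PARAMETERS of a parametrised chain (`SoloInformedPTerm`, files `SoloInformedParamTerm`,
`…TermI`, `…CoinI`).

* `SoloInformedPTerm.scaledConst kc r` — the term over the parameter space `ℝ^K` that denotes, at
  the parameter `q`, the `ℚ`-representation `r` with its integrand multiplied by the coordinate
  `q kc`: domain `r.domain`, integrand `q kc · r.integrand` ON the domain (`repI_scaledConst_domain`,
  `repI_scaledConst_integrand`); it is I-admissible at every parameter (`admI_scaledConst`) and its
  denotation is `KZ_ℝ`-congruent to the integrand scaling `soloInformedRealScaleRep (q kc) (r ⊗ ℝ)`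
  (`of_repI_scaledConst_sub_mem`; the two differ only off the domain).  Its graph family is the
  coordinate preimage of the graph of `(x, c) ↦ c · f x` (`soloInformedScaledGraph`, `ℚ`-semialgebraic by
  the product rule for semialgebraic functions), so the coincidence clause with it is a first-order
  condition on the parameters (`SoloInformedPTerm.isSemialgebraic_setOf_coin`, unchanged).
* `coin_of_repI_graph`, `coin_scaledConst_of_repI_eq`, `of_repI_sub_realScale_mem_of_coin` — a term
  that denotes `c • (r ⊗ ℝ)` at `q` coincides with `scaledConst kc r` there (`c = q kc`), and a term
  coinciding with `scaledConst kc r` at `q` denotes something `KZ_ℝ`-congruent to `(q kc) • (r ⊗ ℝ)`.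
* `soloInformedScalarCombo x₀ X s = x₀ + ∑ᵢ sᵢ • Xᵢ` and the INCREMENT IDENTITY
  `x(s') − x(s) ≡ (s'ᵢ − sᵢ) • Xᵢ` when `s'` and `s` differ only at `i`
  (`soloInformed_scalarCombo_sub_mem_relations`), with its consequences: two relations `x(s), x(s')`
  with `s'ᵢ ≠ sᵢ` force `Xᵢ ∈ relations ℝ` (`soloInformed_mem_relations_of_scalarCombo_pair`), and
  all `Xᵢ ∈ relations ℝ` force `x₀ ∈ relations ℝ` (`soloInformed_base_mem_relations_of_scalarCombo`).

Nothing here is conditional; the semi-generic transfer theorem itself (file B) adds the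
definability of `KZ_ℝ`-relations and genericity of algebraically independent scalar tuples.
References: M. Kontsevich, D. Zagier, *Periods* (2001), §1.1–1.2; J. Bochnak, M. Coste,
M.-F. Roy, *Real Algebraic Geometry* (1998), §2.2 (Prop. 2.2.6: products of semialgebraic functions).
-/

noncomputable section

open Set MeasureTheory MvPolynomial Literature.ModelTheory.ExponentialFields
  Literature.NumberTheory.Transcendental

namespace Summit.KontsevichZagierPeriods.KontsevichZagierPeriods.Theorems

variable {K : Type} {n m : ℕ}

/-! ### The graph of `(x, c) ↦ c · f x` -/

/-- The graph of the function `(x, c) ↦ c · r.integrand x` over `r.domain × ℝ ⊆ ℝ^{n+1}`, as a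
subset of `ℝ^{n+2}` (coordinates `x, c, value`). -/
def soloInformedScaledGraph (r : KZOver.IntegralRep ℚ n) : Set (Fin (n + 1 + 1) → ℝ) :=
  {y | Fin.init y ∈ {z : Fin (n + 1) → ℝ | Fin.init z ∈ r.domain} ∧
    y (Fin.last (n + 1)) = Fin.init y (Fin.last n) * r.integrand (Fin.init (Fin.init y))}

/-- Membership in the scaled graph. [cite: BochnakCosteRoy1998, §2.2] -/
theorem soloInformed_mem_scaledGraph (r : KZOver.IntegralRep ℚ n) (y : Fin (n + 1 + 1) → ℝ) :
    y ∈ soloInformedScaledGraph r ↔ Fin.init (Fin.init y) ∈ r.domain ∧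
      y (Fin.last (n + 1)) = Fin.init y (Fin.last n) * r.integrand (Fin.init (Fin.init y)) :=
  Iff.rfl

/-- `z ↦ r.integrand (init z)` is a `ℚ`-semialgebraic function on the cylinder `r.domain × ℝ`
(its graph is a coordinate preimage of the graph of `r.integrand`). [cite: BochnakCosteRoy1998, §2.2] -/
theorem soloInformed_isSemialgebraicFunOn_integrand_init (r : KZOver.IntegralRep ℚ n) :
    IsSemialgebraicFunOn ℚ {z : Fin (n + 1) → ℝ | Fin.init z ∈ r.domain}
      (fun z => r.integrand (Fin.init z)) := by
  rw [isSemialgebraicFunOn_iff]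
  let ρ : Fin (n + 1) → Fin (n + 1 + 1) := fun j =>
    Fin.lastCases (motive := fun _ => Fin (n + 1 + 1)) (Fin.last (n + 1))
      (fun i => Fin.castSucc (Fin.castSucc i)) j
  have hD : IsSemialgebraic ℚ {z : Fin (n + 1) → ℝ | Fin.init z ∈ r.domain} :=
    r.isSemialgebraic_domain.setOf_init_mem
  have hΓ := (isSemialgebraicFunOn_iff.mp r.isSemialgebraicFunOn_integrand).preimage_comp ρ
  convert hD.setOf_init_mem.inter hΓ using 1
  have hinit : ∀ y : Fin (n + 1 + 1) → ℝ, Fin.init (y ∘ ρ) = Fin.init (Fin.init y) := by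
    intro y; ext i; simp [Fin.init, ρ]
  have hlast : ∀ y : Fin (n + 1 + 1) → ℝ, (y ∘ ρ) (Fin.last n) = y (Fin.last (n + 1)) := by
    intro y; simp [ρ]
  ext y
  simp only [mem_setOf_eq, mem_inter_iff, mem_preimage, hinit, hlast]
  exact ⟨fun h => ⟨h.1, h.1, h.2⟩, fun h => ⟨h.1, h.2.2⟩⟩

/-- **The scaled graph is `ℚ`-semialgebraic**: it is the graph of the product of the two
`ℚ`-semialgebraic functions `z ↦ z_last` and `z ↦ r.integrand (init z)` on `r.domain × ℝ`.
[cite: BochnakCosteRoy1998, Prop. 2.2.6] -/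
theorem soloInformed_isSemialgebraic_scaledGraph (r : KZOver.IntegralRep ℚ n) :
    IsSemialgebraic ℚ (soloInformedScaledGraph r) := by
  have hD : IsSemialgebraic ℚ {z : Fin (n + 1) → ℝ | Fin.init z ∈ r.domain} :=
    r.isSemialgebraic_domain.setOf_init_mem
  have h₁ : IsSemialgebraicFunOn ℚ {z : Fin (n + 1) → ℝ | Fin.init z ∈ r.domain}
      (fun z => z (Fin.last n)) :=
    (isSemialgebraicFunOn_aeval hD (X (Fin.last n))).congr fun z _ => aeval_X z (Fin.last n)
  have h := IsSemialgebraicFunOn.mul_holds h₁ (soloInformed_isSemialgebraicFunOn_integrand_init r)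
  exact isSemialgebraicFunOn_iff.mp h

/-- The coordinate map behind the graph family of the scaled constant term:
`(x, c, value) ↦` positions `(inr x, inl kc, inr last)` of `K ⊕ Fin (n+1)`. -/
def soloInformedScaledIdx (kc : K) (n : ℕ) : Fin (n + 1 + 1) → K ⊕ Fin (n + 1) := fun j =>
  Fin.lastCases (motive := fun _ => K ⊕ Fin (n + 1)) (Sum.inr (Fin.last n))
    (fun j' => Fin.lastCases (motive := fun _ => K ⊕ Fin (n + 1)) (Sum.inl kc)
      (fun i => Sum.inr (Fin.castSucc i)) j') j

/-- The value slot. [cite: BochnakCosteRoy1998, §2.2] -/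
@[simp] theorem soloInformed_scaledIdx_last (kc : K) (n : ℕ) :
    soloInformedScaledIdx kc n (Fin.last (n + 1)) = Sum.inr (Fin.last n) := by
  simp [soloInformedScaledIdx]

/-- The scalar slot. [cite: BochnakCosteRoy1998, §2.2] -/
@[simp] theorem soloInformed_scaledIdx_castSucc_last (kc : K) (n : ℕ) :
    soloInformedScaledIdx kc n (Fin.castSucc (Fin.last n)) = Sum.inl kc := by
  simp [soloInformedScaledIdx]

/-- The domain slots. [cite: BochnakCosteRoy1998, §2.2] -/
@[simp] theorem soloInformed_scaledIdx_castSucc_castSucc (kc : K) (i : Fin n) :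
    soloInformedScaledIdx kc n (Fin.castSucc (Fin.castSucc i)) = Sum.inr (Fin.castSucc i) := by
  simp [soloInformedScaledIdx]

namespace SoloInformedPTerm

/-! ### The scaled constant term -/

/-- **Scaled constant term** of a `ℚ`-representation `r` with scalar coordinate `kc : K`: domain
family `ℝ^K × r.domain`, graph family `{(q, x, t) | x ∈ r.domain, t = q kc · r.integrand x}`,
ambient function `r.integrand`. -/
def scaledConst (kc : K) (r : KZOver.IntegralRep ℚ n) : SoloInformedPTerm K n where
  S := {w | w ∘ Sum.inr ∈ r.domain}
  G := {w | w ∘ soloInformedScaledIdx kc n ∈ soloInformedScaledGraph r}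
  φ := r.integrand
  hS := r.isSemialgebraic_domain.preimage_comp Sum.inr
  hG := (soloInformed_isSemialgebraic_scaledGraph r).preimage_comp (soloInformedScaledIdx kc n)

variable (kc : K) (r : KZOver.IntegralRep ℚ n) (q : K → ℝ)

/-- Fibres of the scaled constant term. [cite: KontsevichZagier2001, §1.1] -/
@[simp] theorem fibre_scaledConst : (scaledConst kc r).fibre q = r.domain := by
  ext x
  show Sum.elim q x ∘ Sum.inr ∈ r.domain ↔ x ∈ r.domain
  rw [Sum.elim_comp_inr]

/-- Graph fibres of the scaled constant term. [cite: KontsevichZagier2001, §1.1] -/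
theorem mem_gfibre_scaledConst (z : Fin (n + 1) → ℝ) : z ∈ (scaledConst kc r).gfibre q ↔
    Fin.init z ∈ r.domain ∧ z (Fin.last n) = q kc * r.integrand (Fin.init z) := by
  have h1 : Fin.init (Fin.init (Sum.elim q z ∘ soloInformedScaledIdx kc n)) = Fin.init z := by
    ext i; simp [Fin.init]
  have h2 : (Sum.elim q z ∘ soloInformedScaledIdx kc n) (Fin.last (n + 1)) = z (Fin.last n) := by
    simp
  have h3 : Fin.init (Sum.elim q z ∘ soloInformedScaledIdx kc n) (Fin.last n) = q kc := by
    simp [Fin.init]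
  show Sum.elim q z ∘ soloInformedScaledIdx kc n ∈ soloInformedScaledGraph r ↔ _
  rw [soloInformed_mem_scaledGraph, h1, h2, h3]

/-- Graph fibres of the scaled constant term over a point of the domain.
[cite: KontsevichZagier2001, §1.1] -/
theorem snoc_mem_gfibre_scaledConst {x : Fin n → ℝ} (hx : x ∈ r.domain) (t : ℝ) :
    Fin.snoc x t ∈ (scaledConst kc r).gfibre q ↔ t = q kc * r.integrand x := by
  rw [mem_gfibre_scaledConst, Fin.init_snoc, Fin.snoc_last]
  exact ⟨fun h => h.2, fun h => ⟨hx, h⟩⟩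

/-- Graph values of the scaled constant term. [cite: KontsevichZagier2001, §1.1] -/
theorem gval_scaledConst {x : Fin n → ℝ} (hx : x ∈ r.domain) :
    (scaledConst kc r).gval q x = q kc * r.integrand x :=
  (snoc_mem_gfibre_scaledConst kc r q hx _).1
    (gval_spec ⟨q kc * r.integrand x, (snoc_mem_gfibre_scaledConst kc r q hx _).2 rfl⟩)

/-- **The scaled constant term is I-admissible at every parameter** (its graph fibre is the graph
of the integrand scaling `(q kc) • (r ⊗ ℝ)`). [cite: KontsevichZagier2001, §1.1] -/
theorem admI_scaledConst : (scaledConst kc r).SoloInformedAdmI q :=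
  admI_of_graph (soloInformedRealScaleRep (q kc) (r.baseChange ℝ)) (fibre_scaledConst kc r q).symm
    fun x hx t => by
      rw [fibre_scaledConst] at hx
      exact snoc_mem_gfibre_scaledConst kc r q hx t

/-- Domain of the denotation of the scaled constant term. [cite: KontsevichZagier2001, §1.1] -/
theorem repI_scaledConst_domain : ((scaledConst kc r).repI q).domain = r.domain := by
  rw [repI_domain (admI_scaledConst kc r q), fibre_scaledConst]

/-- Integrand of the denotation of the scaled constant term ON the domain: `q kc · r.integrand`.
(Off the domain it is `r.integrand`; the calculus never reads those values.)
[cite: KontsevichZagier2001, §1.1] -/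
theorem repI_scaledConst_integrand {x : Fin n → ℝ} (hx : x ∈ r.domain) :
    ((scaledConst kc r).repI q).integrand x = q kc * r.integrand x := by
  rw [repI_integrand (admI_scaledConst kc r q)]
  exact hybrid_eq_of_mem (admI_scaledConst kc r q).1 (by rwa [fibre_scaledConst])
    ((snoc_mem_gfibre_scaledConst kc r q hx _).2 rfl)

/-- **The scaled constant term denotes `(q kc) • (r ⊗ ℝ)` up to a `KZ_ℝ`-relation**: the
denotation and the integrand scaling `soloInformedRealScaleRep (q kc) (r ⊗ ℝ)` have the same domain
and integrands equal on it. [cite: KontsevichZagier2001, §1.2] -/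
theorem of_repI_scaledConst_sub_mem :
    KZOver.of ((scaledConst kc r).repI q) -
        KZOver.of (soloInformedRealScaleRep (q kc) (r.baseChange ℝ)) ∈ KZOver.relations ℝ :=
  soloInformed_sub_mem_relations_of_eqOn (repI_scaledConst_domain kc r q) fun x hx => by
    rw [repI_scaledConst_domain] at hx
    rw [soloInformed_realScaleRep_integrand, KZOver.IntegralRep.integrand_baseChange]
    exact repI_scaledConst_integrand kc r q hx

/-! ### Coincidence with a scaled constant term -/

variable {kc r q}

/-- **Coincidence from a graph description of the denotation.** If `T` is I-admissible at `p`,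
its denotation has domain the fibre of `T'` at `p`, and the graph of its integrand over that fibre
lies in the graph fibre of `T'`, then `T` coincides with `T'` at `p`.
[cite: BochnakCosteRoy1998, Prop. 2.2.4] -/
theorem coin_of_repI_graph {d : ℕ} {T T' : SoloInformedPTerm K d} {p : K → ℝ}
    (hT : T.SoloInformedAdmI p) (hfib : (T.repI p).domain = T'.fibre p)
    (hgr : ∀ x ∈ T'.fibre p, Fin.snoc x ((T.repI p).integrand x) ∈ T'.gfibre p) :
    T.SoloInformedCoin T' p := by
  rw [repI_domain hT] at hfib
  rw [repI_integrand hT] at hgr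
  refine ⟨fun x => by rw [hfib], fun z hz hzG => ?_⟩
  have h1 : T.hybrid p (Fin.init z) = z (Fin.last d) :=
    hybrid_eq_of_mem hT.1 hz (t := z (Fin.last d)) (by rwa [Fin.snoc_init_self])
  have h2 := hgr (Fin.init z) (hfib ▸ hz)
  rwa [h1, Fin.snoc_init_self] at h2

/-- **A term denoting `c • (r ⊗ ℝ)` at `q`, with `c = q kc`, coincides with `scaledConst kc r`
at `q`.** [cite: KontsevichZagier2001, §1.1] -/
theorem coin_scaledConst_of_repI_eq {T : SoloInformedPTerm K n} (hT : T.SoloInformedAdmI q)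
    (h : T.repI q = soloInformedRealScaleRep (q kc) (r.baseChange ℝ)) :
    T.SoloInformedCoin (scaledConst kc r) q :=
  coin_of_repI_graph hT (by rw [h, fibre_scaledConst]; rfl) fun x hx => by
    rw [fibre_scaledConst] at hx
    rw [h, snoc_mem_gfibre_scaledConst kc r q hx]
    rfl

/-- **Pinning by a scaled constant term, up to a relation.** A term that is I-admissible at `q`
and coincides with `scaledConst kc r` there denotes a representation `KZ_ℝ`-congruent to the
integrand scaling `(q kc) • (r ⊗ ℝ)`. [cite: KontsevichZagier2001, §1.2] -/
theorem of_repI_sub_realScale_mem_of_coin {T : SoloInformedPTerm K n} (hT : T.SoloInformedAdmI q)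
    (h : T.SoloInformedCoin (scaledConst kc r) q) :
    KZOver.of (T.repI q) - KZOver.of (soloInformedRealScaleRep (q kc) (r.baseChange ℝ)) ∈
      KZOver.relations ℝ := by
  have h₁ := of_repI_sub_mem_of_coin h hT (admI_scaledConst kc r q)
  have h₂ := of_repI_scaledConst_sub_mem kc r q
  have h₃ := add_mem h₁ h₂
  rwa [sub_add_sub_cancel] at h₃

/-- The same congruence read through `soloInformedRealScale` on the generator `[r ⊗ ℝ]`.
[cite: KontsevichZagier2001, §1.2] -/
theorem of_repI_sub_realScale_of_mem_of_coin {T : SoloInformedPTerm K n}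
    (hT : T.SoloInformedAdmI q) (h : T.SoloInformedCoin (scaledConst kc r) q) :
    KZOver.of (T.repI q) - soloInformedRealScale (q kc) (KZOver.of (r.baseChange ℝ)) ∈
      KZOver.relations ℝ := by
  rw [soloInformed_realScale_of]
  exact of_repI_sub_realScale_mem_of_coin hT h

end SoloInformedPTerm

/-! ### Scalar increments -/

/-- **`c • x − d • x ≡ (c − d) • x`** modulo `relations ℝ`. [cite: KontsevichZagier2001, §1.2] -/
theorem soloInformed_realScale_sub_mem_relations (c d : ℝ) (x : KZOver.FormalRep ℝ) :
    soloInformedRealScale c x - soloInformedRealScale d x - soloInformedRealScale (c - d) x ∈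
      KZOver.relations ℝ := by
  have h := soloInformed_realScale_add_mem_relations (c - d) d x
  rw [sub_add_cancel] at h
  have he : soloInformedRealScale c x - soloInformedRealScale d x - soloInformedRealScale (c - d) x =
      soloInformedRealScale c x - soloInformedRealScale (c - d) x - soloInformedRealScale d x := by
    abel
  rw [he]
  exact h

/-- **Cancelling a non-zero scalar**: `c ≠ 0` and `c • x ∈ relations ℝ` give `x ∈ relations ℝ`
(`x = c⁻¹ • (c • x)` on the nose). [cite: KontsevichZagier2001, §1.2] -/
theorem soloInformed_mem_relations_of_realScale_mem {c : ℝ} (hc : c ≠ 0) {x : KZOver.FormalRep ℝ}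
    (h : soloInformedRealScale c x ∈ KZOver.relations ℝ) : x ∈ KZOver.relations ℝ := by
  have h' := soloInformed_realScale_mem_relations c⁻¹ h
  rwa [← soloInformed_realScale_mul, inv_mul_cancel₀ hc, soloInformed_realScale_one] at h'

/-- **Scalar combination** `x(s) = x₀ + ∑ᵢ sᵢ • Xᵢ` of formal combinations with real scalar
parameters `s : Fin m → ℝ`. -/
def soloInformedScalarCombo (x₀ : KZOver.FormalRep ℝ) (X : Fin m → KZOver.FormalRep ℝ)
    (s : Fin m → ℝ) : KZOver.FormalRep ℝ :=
  x₀ + ∑ i, soloInformedRealScale (s i) (X i)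

/-- Unfolding the scalar combination. [cite: KontsevichZagier2001, §1.2] -/
theorem soloInformed_scalarCombo_def (x₀ : KZOver.FormalRep ℝ) (X : Fin m → KZOver.FormalRep ℝ)
    (s : Fin m → ℝ) :
    soloInformedScalarCombo x₀ X s = x₀ + ∑ i, soloInformedRealScale (s i) (X i) := rfl

/-- **Increment identity.** If the scalar tuples `s'` and `s` agree off the index `i`, then
`x(s') − x(s) ≡ (s'ᵢ − sᵢ) • Xᵢ` modulo `relations ℝ`. [cite: KontsevichZagier2001, §1.2] -/
theorem soloInformed_scalarCombo_sub_mem_relations (x₀ : KZOver.FormalRep ℝ)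
    (X : Fin m → KZOver.FormalRep ℝ) {s s' : Fin m → ℝ} {i : Fin m} (h : ∀ j, j ≠ i → s' j = s j) :
    soloInformedScalarCombo x₀ X s' - soloInformedScalarCombo x₀ X s -
        soloInformedRealScale (s' i - s i) (X i) ∈ KZOver.relations ℝ := by
  have hsum : soloInformedScalarCombo x₀ X s' - soloInformedScalarCombo x₀ X s =
      soloInformedRealScale (s' i) (X i) - soloInformedRealScale (s i) (X i) := by
    rw [soloInformed_scalarCombo_def, soloInformed_scalarCombo_def, add_sub_add_left_eq_sub,
      ← Finset.sum_sub_distrib]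
    refine Finset.sum_eq_single i (fun j _ hj => ?_) (fun hi => absurd (Finset.mem_univ i) hi)
    rw [h j hj, sub_self]
  rw [hsum]
  exact soloInformed_realScale_sub_mem_relations (s' i) (s i) (X i)

/-- **Two relations along a scalar line isolate the coefficient.** If `x(s)` and `x(s')` are both
`KZ_ℝ`-relations and `s'` differs from `s` exactly at `i`, then `Xᵢ ∈ relations ℝ`.
[cite: KontsevichZagier2001, §1.2] -/
theorem soloInformed_mem_relations_of_scalarCombo_pair (x₀ : KZOver.FormalRep ℝ)
    (X : Fin m → KZOver.FormalRep ℝ) {s s' : Fin m → ℝ} {i : Fin m}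
    (h : ∀ j, j ≠ i → s' j = s j) (hi : s' i ≠ s i)
    (hs : soloInformedScalarCombo x₀ X s ∈ KZOver.relations ℝ)
    (hs' : soloInformedScalarCombo x₀ X s' ∈ KZOver.relations ℝ) : X i ∈ KZOver.relations ℝ := by
  have h₁ := soloInformed_scalarCombo_sub_mem_relations x₀ X h
  have h₂ : soloInformedRealScale (s' i - s i) (X i) ∈ KZOver.relations ℝ := by
    have h₃ := sub_mem (sub_mem hs' hs) h₁
    rwa [sub_sub_cancel] at h₃
  exact soloInformed_mem_relations_of_realScale_mem (sub_ne_zero.2 hi) h₂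

/-- **The base term.** If `x(s)` is a `KZ_ℝ`-relation and every `Xᵢ` is one, then so is `x₀`.
[cite: KontsevichZagier2001, §1.2] -/
theorem soloInformed_base_mem_relations_of_scalarCombo (x₀ : KZOver.FormalRep ℝ)
    (X : Fin m → KZOver.FormalRep ℝ) (s : Fin m → ℝ)
    (hs : soloInformedScalarCombo x₀ X s ∈ KZOver.relations ℝ)
    (hX : ∀ i, X i ∈ KZOver.relations ℝ) : x₀ ∈ KZOver.relations ℝ := by
  have hsum : ∑ i, soloInformedRealScale (s i) (X i) ∈ KZOver.relations ℝ :=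
    sum_mem fun i _ => soloInformed_realScale_mem_relations (s i) (hX i)
  have h := sub_mem hs hsum
  rwa [soloInformed_scalarCombo_def, add_sub_cancel_right] at h

/-- **The semi-generic element of THEOREM T⊗** in this notation: for `ℚ`-data `q₀, qᵢ` and real
scalars `t`, `(q₀ ⊗ ℝ) + ∑ᵢ tᵢ • (qᵢ ⊗ ℝ)` is the scalar combination of the base changes.
[cite: KontsevichZagier2001, §1.2] -/
theorem soloInformed_scalarCombo_baseChange (q₀ : KZOver.FormalRep ℚ) (q : Fin m → KZOver.FormalRep ℚ)
    (t : Fin m → ℝ) :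
    soloInformedScalarCombo (KZOver.baseChange ℚ ℝ q₀) (fun i => KZOver.baseChange ℚ ℝ (q i)) t =
      KZOver.baseChange ℚ ℝ q₀ + ∑ i, soloInformedRealScale (t i) (KZOver.baseChange ℚ ℝ (q i)) :=
  rfl

end Summit.KontsevichZagierPeriods.KontsevichZagierPeriods.Theorems
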